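import Summits.QuantumFields.YangMills.Theorems.DiagonalMirrorRPRWilsonDiagonalModelLinkKernel
import Summits.QuantumFields.YangMills.Theorems.DiagonalMirrorRPRWilsonDiagonalModelChainResum
import Summits.QuantumFields.YangMills.Theorems.DiagonalMirrorRPRWilsonDiagonalModelAbsResum

/-!
# Crux `WeakCouplingHypercubicLimitRP` (stmt-QuantumFields-27398) / aside `DiagonalMirrorRPR` (stmt-QuantumFields-10604), door B,
# construction F1_diag — PAIRING LAYER, step P3b: the MASTER LIFT of an inserted pair chain to the link-kernel chain over `μ̃ ⊗ halfHaar`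

Helper file (`--supports stmt-QuantumFields-27398 --as helper`) of the hand `hand-10604-wilsonDiagModel-3` (docket director-ym g23,
R695/R701-ym, O4 WORD 30: step P3 of hand-1's ROADMAP-F1diag v4 §1⅞ / hand-2's addendum v5); it closes nothing by itself.

WHAT.  hand-1's trace formula lifts the pair chain `∏_i e^{β even_i} e^{β odd_i}` (kernel `K_u`, NOT symmetric) to the cyclic chain of the
bounded symmetric kernel `𝔟` on `L²(μ̃)` by expanding every even half step through the feature lift and integrating out EVERY bond half layer.
For the pairing identities an observable `J` of the pair string rides along, and the bond half layers it reads must survive.  This file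
proves the general **master lift** (`integral_mul_pairChain_eq_integral_linkChain`): for every finite index type `ι` with a successor
PERMUTATION `σ`, every bounded measurable `J : (ι → HalfCfg × HalfCfg) → ℝ`, `β ≥ 0`, `ρ` continuous unitary and a bond bound `M`,

  `∫ J(P) ∏_i e^{β even(Y_i,X_i,Y_{σ i})} e^{β odd(X_i,Y_{σ i},X_{σ i})} d(halfHaar ⊗ halfHaar)^{⊗ι}(P)`
  `  = ∫ J((Y_i, X_i)_i) ∏_i c(V_i, Y_{σ i}, V_{σ i}) d(μ̃ ⊗ halfHaar)^{⊗ι}(U)`,   `U_i = (V_i, Y_i) = ((k_i, X_i), Y_i)`,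

where `c = linkKer ρ β M` is the link kernel of `…LinkKernel` and `μ̃ = tMeasure` the finite reweighted measure of `…Reweight`: the sites of
the lifted chain are `(lifted state, bond half layer)` pairs, every bond half layer is still present, and integrating any one of them out
produces `𝔟` (`integral_linkKer`).  Steps: pointwise feature expansion (hand-1's `hasSum_chainIntegrand`) with the uniform absolute bound
`exists_hasSum_abs_chainSummand_le` (⇒ `∫ Σ' = Σ' ∫`, `integral_mul_tsum_chainSummand`), the product identity
`prod_linkKer_mul_prod_featWeight`, and the atoms `∏_i w_{k_i}` of `(w·count)^{⊗ι}` (`integral_countable`, `Measure.pi_singleton`) after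
un-zipping `U ↦ ((k, X), Y)` (`measurePreserving_arrowProdEquivProdArrow`, Fubini on bounded integrands over finite measures).

HONEST FRAMING: bookkeeping only; `wilsonDiagonalModel` is NOT landed here; no letter is proved; D1, ⟨27398⟩, S6i and the aside ⟨10604⟩ are
OPEN; nothing here bears on the summit; the Yang–Mills mass gap is NOT proved here or anywhere in the tree.  No definition, no instance, no
notation, `autoImplicit false`.

References: K. Osterwalder, E. Seiler, Ann. Phys. 110 (1978) §2–3; E. Seiler, LNP 159 (1982) Ch. 2.
-/

set_option autoImplicit false

noncomputable section

open scoped BigOperators ENNReal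
open MeasureTheory Function
open Literature.MathematicalPhysics.QuantumLattice Literature.MathematicalPhysics.QuantumFieldTheory
open Summit.QuantumFields.YangMills.Cruxes.DiagonalMirrorRPR.ParityBridgeColdTraces

namespace Summit.QuantumFields.YangMills.Cruxes.DiagonalMirrorRPR.SignTwistedDiagonalTrace.WilsonDiagonal

/-! ## §1 The feature-expanded summand of the pair chain on a general finite index type -/

section Summand

variable {S : ℕ} [NeZero S] {G : Type} [Group G] {Nc : ℕ} (ρ : G →* Matrix (Fin Nc) (Fin Nc) ℂ)
variable [TopologicalSpace G] [IsTopologicalGroup G] [CompactSpace G] [MeasurableSpace G] [BorelSpace G]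
  [SecondCountableTopology G]

omit [MeasurableSpace G] [BorelSpace G] [SecondCountableTopology G] in
/-- **Uniform absolute summability of the feature expansion** on a general finite index type with successor map `σ`:
`Σ_{k ∈ ℕ^ι} |∏_i e^{β inslab X_i} ψ_{k_i}(w(ΘY_{σ i})) ψ_{k_i}(w(Y_i)) e^{β odd(X_i,Y_{σ i},X_{σ i})}| ≤ B` for all `Y, X` (hand-1's
`exists_hasSum_abs_prod_chainFactor_le`, verbatim for `ι, σ`). -/
theorem exists_hasSum_abs_chainSummand_le (hρ : Continuous ρ) {β : ℝ} (hβ : 0 ≤ β) {ι : Type*} [Fintype ι] (σ : ι → ι) :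
    ∃ B : ℝ, ∀ Y X : ι → HalfCfg S S G, ∃ s : ℝ,
      HasSum (fun k : ι → ℕ => |∏ i, Real.exp (β * inslabAction ρ (X i)) *
        (natFeature (p := featDim S Nc) β (k i) (bondVec ρ (thetaHalf (Y (σ i)))) *
          natFeature (p := featDim S Nc) β (k i) (bondVec ρ (Y i))) *
        Real.exp (β * oddActionU ρ (X i) (Y (σ i)) (X (σ i)))|) s ∧ s ≤ B := by
  obtain ⟨Co, hCo, hodd⟩ := exists_exp_oddActionU_le (S := S) ρ hρ β
  obtain ⟨Ci, hCi, hins⟩ := exists_exp_inslabAction_le (S := S) ρ hρ (2 * β)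
  obtain ⟨M, hM⟩ := exists_abs_bondVec_le (S := S) (Nc := Nc) ρ hρ
  have hins' : ∀ X : HalfCfg S S G, Real.exp (β * inslabAction ρ X) ≤ Ci := fun X => by
    have := hins X; rwa [show 2 * β / 2 = β by ring] at this
  set E : ℝ := Real.exp (β * (featDim S Nc * M ^ 2)) with hE
  refine ⟨∏ _i : ι, Ci * E * Co, fun Y X => ?_⟩
  -- per-factor absolute sums
  have hfac : ∀ i : ι, HasSum (fun k : ℕ => |Real.exp (β * inslabAction ρ (X i)) *
        (natFeature (p := featDim S Nc) β k (bondVec ρ (thetaHalf (Y (σ i)))) *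
          natFeature (p := featDim S Nc) β k (bondVec ρ (Y i))) *
        Real.exp (β * oddActionU ρ (X i) (Y (σ i)) (X (σ i)))|)
      (Real.exp (β * inslabAction ρ (X i)) *
        Real.exp (β * ∑ j, |bondVec ρ (thetaHalf (Y (σ i))) j| * |bondVec ρ (Y i) j|) *
        Real.exp (β * oddActionU ρ (X i) (Y (σ i)) (X (σ i)))) := by
    intro i
    have h := ((hasSum_abs_natFeature_mul hβ (bondVec ρ (thetaHalf (Y (σ i)))) (bondVec ρ (Y i))).mul_left
      (Real.exp (β * inslabAction ρ (X i)))).mul_right (Real.exp (β * oddActionU ρ (X i) (Y (σ i)) (X (σ i))))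
    refine h.congr_fun fun k => ?_
    simp only [abs_mul, abs_of_pos (Real.exp_pos _)]
  -- the product over `i`
  have hprod := hasSum_pi_prod_fintype (ι := ι)
    (f := fun i k => |Real.exp (β * inslabAction ρ (X i)) *
        (natFeature (p := featDim S Nc) β k (bondVec ρ (thetaHalf (Y (σ i)))) *
          natFeature (p := featDim S Nc) β k (bondVec ρ (Y i))) *
        Real.exp (β * oddActionU ρ (X i) (Y (σ i)) (X (σ i)))|) (fun i => hfac i)
    (fun i => by simpa only [Real.norm_eq_abs, abs_abs] using (hfac i).summable)
  simp only [← Finset.abs_prod] at hprod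
  refine ⟨_, hprod, Finset.prod_le_prod (fun i _ => by positivity) fun i _ => ?_⟩
  have h2 : Real.exp (β * ∑ j, |bondVec ρ (thetaHalf (Y (σ i))) j| * |bondVec ρ (Y i) j|) ≤ E := by
    rw [← (hasSum_abs_natFeature_mul hβ _ _).tsum_eq, hE]
    exact tsum_abs_natFeature_mul_le hβ (fun j => hM _ j) (fun j => hM _ j)
  exact mul_le_mul (mul_le_mul (hins' _) h2 (Real.exp_pos _).le hCi.le) (hodd _ _ _) (Real.exp_pos _).le (by positivity)

omit [CompactSpace G] in
/-- Each summand of the feature expansion is measurable in the pair string `P = (Y_i, X_i)_i`. -/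
theorem measurable_chainSummand (hρ : Continuous ρ) (β : ℝ) {ι : Type*} [Fintype ι] (σ : ι → ι) (k : ι → ℕ) :
    Measurable fun P : ι → HalfCfg S S G × HalfCfg S S G => ∏ i, Real.exp (β * inslabAction ρ (P i).2) *
        (natFeature (p := featDim S Nc) β (k i) (bondVec ρ (thetaHalf (P (σ i)).1)) *
          natFeature (p := featDim S Nc) β (k i) (bondVec ρ (P i).1)) *
        Real.exp (β * oddActionU ρ (P i).2 (P (σ i)).1 (P (σ i)).2) := by
  have hm1 : ∀ s : ι, Measurable fun P : ι → HalfCfg S S G × HalfCfg S S G => (P s).1 := fun s =>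
    measurable_fst.comp (measurable_pi_apply s)
  have hm2 : ∀ s : ι, Measurable fun P : ι → HalfCfg S S G × HalfCfg S S G => (P s).2 := fun s =>
    measurable_snd.comp (measurable_pi_apply s)
  have hins : Continuous fun X : HalfCfg S S G => Real.exp (β * inslabAction ρ X) := by
    refine Real.continuous_exp.comp (continuous_const.mul ?_)
    unfold inslabAction
    refine continuous_finsetSum _ fun s _ => Complex.continuous_re.comp (Continuous.matrix_trace (hρ.comp ?_))
    fun_prop
  have hodd : Continuous fun tr : HalfCfg S S G × HalfCfg S S G × HalfCfg S S G =>
      Real.exp (β * oddActionU ρ tr.1 tr.2.1 tr.2.2) :=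
    Real.continuous_exp.comp (continuous_const.mul (continuous_oddActionU ρ hρ))
  refine Finset.measurable_prod _ fun i _ => ?_
  have hI : Measurable fun P : ι → HalfCfg S S G × HalfCfg S S G => Real.exp (β * inslabAction ρ (P i).2) := by
    simpa only [Function.comp_def] using hins.measurable.comp (hm2 i)
  have hA : Measurable fun P : ι → HalfCfg S S G × HalfCfg S S G =>
      natFeature (p := featDim S Nc) β (k i) (bondVec ρ (thetaHalf (P (σ i)).1)) := by
    simpa only [Function.comp_def] using
      ((continuous_natFeature_bondVec ρ hρ β (k i)).comp continuous_thetaHalf).measurable.comp (hm1 (σ i))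
  have hB : Measurable fun P : ι → HalfCfg S S G × HalfCfg S S G =>
      natFeature (p := featDim S Nc) β (k i) (bondVec ρ (P i).1) := by
    simpa only [Function.comp_def] using (continuous_natFeature_bondVec ρ hρ β (k i)).measurable.comp (hm1 i)
  have hO : Measurable fun P : ι → HalfCfg S S G × HalfCfg S S G =>
      Real.exp (β * oddActionU ρ (P i).2 (P (σ i)).1 (P (σ i)).2) := by
    simpa only [Function.comp_def] using hodd.measurable.comp ((hm2 i).prodMk ((hm1 (σ i)).prodMk (hm2 (σ i))))
  exact (hI.mul (hA.mul hB)).mul hO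

omit [CompactSpace G] in
/-- The pair chain `P ↦ ∏_i e^{β even_i} e^{β odd_i}` is measurable. -/
theorem measurable_pairChain (hρ : Continuous ρ) (β : ℝ) {ι : Type*} [Fintype ι] (σ : ι → ι) :
    Measurable fun P : ι → HalfCfg S S G × HalfCfg S S G => ∏ i,
      Real.exp (β * evenActionU ρ (P i).1 (P i).2 (P (σ i)).1) * Real.exp (β * oddActionU ρ (P i).2 (P (σ i)).1 (P (σ i)).2) := by
  have hm1 : ∀ s : ι, Measurable fun P : ι → HalfCfg S S G × HalfCfg S S G => (P s).1 := fun s =>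
    measurable_fst.comp (measurable_pi_apply s)
  have hm2 : ∀ s : ι, Measurable fun P : ι → HalfCfg S S G × HalfCfg S S G => (P s).2 := fun s =>
    measurable_snd.comp (measurable_pi_apply s)
  have hev : Continuous fun tr : HalfCfg S S G × HalfCfg S S G × HalfCfg S S G =>
      Real.exp (β * evenActionU ρ tr.1 tr.2.1 tr.2.2) := by
    refine Real.continuous_exp.comp (continuous_const.mul ?_)
    unfold evenActionU
    refine continuous_finsetSum _ fun s _ => ?_
    have h : ∀ f : HalfCfg S S G × HalfCfg S S G × HalfCfg S S G → G, Continuous f →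
        Continuous fun t => (ρ (f t)).trace.re := fun f hf =>
      Complex.continuous_re.comp (Continuous.matrix_trace (hρ.comp hf))
    exact (h _ (by fun_prop)).add (h _ (by fun_prop))
  have hodd : Continuous fun tr : HalfCfg S S G × HalfCfg S S G × HalfCfg S S G =>
      Real.exp (β * oddActionU ρ tr.1 tr.2.1 tr.2.2) :=
    Real.continuous_exp.comp (continuous_const.mul (continuous_oddActionU ρ hρ))
  refine Finset.measurable_prod _ fun i _ => ?_
  have hE : Measurable fun P : ι → HalfCfg S S G × HalfCfg S S G =>
      Real.exp (β * evenActionU ρ (P i).1 (P i).2 (P (σ i)).1) := by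
    simpa only [Function.comp_def] using hev.measurable.comp ((hm1 i).prodMk ((hm2 i).prodMk (hm1 (σ i))))
  have hO : Measurable fun P : ι → HalfCfg S S G × HalfCfg S S G =>
      Real.exp (β * oddActionU ρ (P i).2 (P (σ i)).1 (P (σ i)).2) := by
    simpa only [Function.comp_def] using hodd.measurable.comp ((hm2 i).prodMk ((hm1 (σ i)).prodMk (hm2 (σ i))))
  exact hE.mul hO

/-- **`∫ J · (pair chain) = Σ'_k ∫ J · (k-th summand)`** (`∫ Σ' = Σ' ∫`, dominated by the uniform absolute bound): the inserted
pair chain as the sum over feature multi-indices of inserted summands. -/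
theorem integral_mul_pairChain_eq_tsum (hρ : Continuous ρ) {β : ℝ} (hβ : 0 ≤ β) (hρu : ∀ g, ρ g ∈ Matrix.unitaryGroup (Fin Nc) ℂ)
    {ι : Type*} [Fintype ι] (σ : ι → ι) {J : (ι → HalfCfg S S G × HalfCfg S S G) → ℝ} (hJm : Measurable J) {B : ℝ}
    (hJb : ∀ P, |J P| ≤ B) :
    ∫ P : ι → HalfCfg S S G × HalfCfg S S G, J P * ∏ i,
        Real.exp (β * evenActionU ρ (P i).1 (P i).2 (P (σ i)).1) * Real.exp (β * oddActionU ρ (P i).2 (P (σ i)).1 (P (σ i)).2)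
        ∂(Measure.pi fun _ : ι => (halfHaar S G).prod (halfHaar S G)) =
      ∑' k : ι → ℕ, ∫ P : ι → HalfCfg S S G × HalfCfg S S G, J P * ∏ i, Real.exp (β * inslabAction ρ (P i).2) *
        (natFeature (p := featDim S Nc) β (k i) (bondVec ρ (thetaHalf (P (σ i)).1)) *
          natFeature (p := featDim S Nc) β (k i) (bondVec ρ (P i).1)) *
        Real.exp (β * oddActionU ρ (P i).2 (P (σ i)).1 (P (σ i)).2)
        ∂(Measure.pi fun _ : ι => (halfHaar S G).prod (halfHaar S G)) := by
  classical
  haveI : IsProbabilityMeasure (halfHaar S G) := by unfold halfHaar; infer_instance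
  have hB0 : 0 ≤ B := (abs_nonneg _).trans (hJb fun _ => (fun _ => 1, fun _ => 1))
  -- pointwise expansion
  have hpt : ∀ P : ι → HalfCfg S S G × HalfCfg S S G, HasSum (fun k : ι → ℕ => J P * ∏ i, Real.exp (β * inslabAction ρ (P i).2) *
        (natFeature (p := featDim S Nc) β (k i) (bondVec ρ (thetaHalf (P (σ i)).1)) *
          natFeature (p := featDim S Nc) β (k i) (bondVec ρ (P i).1)) *
        Real.exp (β * oddActionU ρ (P i).2 (P (σ i)).1 (P (σ i)).2))
      (J P * ∏ i, Real.exp (β * evenActionU ρ (P i).1 (P i).2 (P (σ i)).1) *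
        Real.exp (β * oddActionU ρ (P i).2 (P (σ i)).1 (P (σ i)).2)) := fun P =>
    (hasSum_chainIntegrand ρ hβ hρu σ (fun i => (P i).1) (fun i => (P i).2)).mul_left (J P)
  have heq : ∀ P : ι → HalfCfg S S G × HalfCfg S S G, J P * ∏ i, Real.exp (β * evenActionU ρ (P i).1 (P i).2 (P (σ i)).1) *
        Real.exp (β * oddActionU ρ (P i).2 (P (σ i)).1 (P (σ i)).2) = ∑' k : ι → ℕ, J P * ∏ i, Real.exp (β * inslabAction ρ (P i).2) *
        (natFeature (p := featDim S Nc) β (k i) (bondVec ρ (thetaHalf (P (σ i)).1)) *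
          natFeature (p := featDim S Nc) β (k i) (bondVec ρ (P i).1)) *
        Real.exp (β * oddActionU ρ (P i).2 (P (σ i)).1 (P (σ i)).2) := fun P => ((hpt P).tsum_eq).symm
  simp_rw [heq]
  obtain ⟨Bc, hBc⟩ := exists_hasSum_abs_chainSummand_le (S := S) (Nc := Nc) ρ hρ hβ σ
  have hmeas : ∀ k : ι → ℕ, Measurable fun P : ι → HalfCfg S S G × HalfCfg S S G => J P * ∏ i, Real.exp (β * inslabAction ρ (P i).2) *
        (natFeature (p := featDim S Nc) β (k i) (bondVec ρ (thetaHalf (P (σ i)).1)) *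
          natFeature (p := featDim S Nc) β (k i) (bondVec ρ (P i).1)) *
        Real.exp (β * oddActionU ρ (P i).2 (P (σ i)).1 (P (σ i)).2) := fun k => hJm.mul (measurable_chainSummand ρ hρ β σ k)
  refine integral_tsum (fun k => (hmeas k).aestronglyMeasurable) (ne_of_lt ?_)
  have hmeas' : ∀ k : ι → ℕ, Measurable fun P : ι → HalfCfg S S G × HalfCfg S S G => ENNReal.ofReal |J P * ∏ i,
      Real.exp (β * inslabAction ρ (P i).2) *
        (natFeature (p := featDim S Nc) β (k i) (bondVec ρ (thetaHalf (P (σ i)).1)) *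
          natFeature (p := featDim S Nc) β (k i) (bondVec ρ (P i).1)) *
        Real.exp (β * oddActionU ρ (P i).2 (P (σ i)).1 (P (σ i)).2)| := fun k => ENNReal.measurable_ofReal.comp (hmeas k).abs
  have hswap : ∑' k : ι → ℕ, ∫⁻ P, ‖J P * ∏ i, Real.exp (β * inslabAction ρ (P i).2) *
        (natFeature (p := featDim S Nc) β (k i) (bondVec ρ (thetaHalf (P (σ i)).1)) *
          natFeature (p := featDim S Nc) β (k i) (bondVec ρ (P i).1)) *
        Real.exp (β * oddActionU ρ (P i).2 (P (σ i)).1 (P (σ i)).2)‖ₑ ∂(Measure.pi fun _ : ι => (halfHaar S G).prod (halfHaar S G)) =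
      ∫⁻ P, ∑' k : ι → ℕ, ENNReal.ofReal |J P * ∏ i, Real.exp (β * inslabAction ρ (P i).2) *
        (natFeature (p := featDim S Nc) β (k i) (bondVec ρ (thetaHalf (P (σ i)).1)) *
          natFeature (p := featDim S Nc) β (k i) (bondVec ρ (P i).1)) *
        Real.exp (β * oddActionU ρ (P i).2 (P (σ i)).1 (P (σ i)).2)|
        ∂(Measure.pi fun _ : ι => (halfHaar S G).prod (halfHaar S G)) := by
    rw [lintegral_tsum fun k => (hmeas' k).aemeasurable]
    refine tsum_congr fun k => lintegral_congr fun P => ?_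
    rw [Real.enorm_eq_ofReal_abs]
  rw [hswap]
  calc ∫⁻ P, ∑' k : ι → ℕ, ENNReal.ofReal |J P * ∏ i, Real.exp (β * inslabAction ρ (P i).2) *
        (natFeature (p := featDim S Nc) β (k i) (bondVec ρ (thetaHalf (P (σ i)).1)) *
          natFeature (p := featDim S Nc) β (k i) (bondVec ρ (P i).1)) *
        Real.exp (β * oddActionU ρ (P i).2 (P (σ i)).1 (P (σ i)).2)| ∂(Measure.pi fun _ => (halfHaar S G).prod (halfHaar S G))
      ≤ ∫⁻ _P, ENNReal.ofReal (B * Bc) ∂(Measure.pi fun _ : ι => (halfHaar S G).prod (halfHaar S G)) := by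
        refine lintegral_mono fun P => ?_
        obtain ⟨s, hs, hsB⟩ := hBc (fun i => (P i).1) (fun i => (P i).2)
        have hs' := hs.mul_left |J P|
        simp only [← abs_mul] at hs'
        rw [← ENNReal.ofReal_tsum_of_nonneg (fun k => abs_nonneg _) hs'.summable, hs'.tsum_eq]
        refine ENNReal.ofReal_le_ofReal ?_
        have hs0 : 0 ≤ s := le_trans (abs_nonneg _) (le_hasSum hs (fun _ => 0) fun _ _ => abs_nonneg _)
        exact mul_le_mul (hJb P) hsB hs0 hB0
    _ = ENNReal.ofReal (B * Bc) := by rw [lintegral_const, measure_univ, mul_one]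
    _ < ⊤ := ENNReal.ofReal_lt_top

end Summand

/-! ## §2 The master lift -/

section Lift

variable {S : ℕ} [NeZero S] {G : Type} [Group G] {Nc : ℕ} (ρ : G →* Matrix (Fin Nc) (Fin Nc) ℂ)
variable [TopologicalSpace G] [IsTopologicalGroup G] [CompactSpace G] [MeasurableSpace G] [BorelSpace G]
  [SecondCountableTopology G]

omit [CompactSpace G] in
/-- The link-kernel chain with insertion, `U ↦ J((Y_i,X_i)_i) ∏_i c(V_i, Y_{σ i}, V_{σ i})`, is measurable on `((ℕ × HalfCfg) × HalfCfg)^ι`. -/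
theorem measurable_mul_linkChain (hρ : Continuous ρ) (β M : ℝ) {ι : Type*} [Fintype ι] (σ : ι → ι)
    {J : (ι → HalfCfg S S G × HalfCfg S S G) → ℝ} (hJm : Measurable J) :
    Measurable fun U : ι → (ℕ × HalfCfg S S G) × HalfCfg S S G =>
      J (fun i => ((U i).2, (U i).1.2)) * ∏ i, linkKer ρ β M (U i).1 (U (σ i)).2 (U (σ i)).1 := by
  have hU : ∀ s : ι, Measurable fun U : ι → (ℕ × HalfCfg S S G) × HalfCfg S S G => U s := fun s => measurable_pi_apply s
  refine (hJm.comp (measurable_pi_lambda _ fun i => ((hU i).snd).prodMk (hU i).fst.snd)).mul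
    (Finset.measurable_prod _ fun i _ => ?_)
  have h := (measurable_linkKer ρ hρ β M).comp (((hU i).fst).prodMk (((hU (σ i)).snd).prodMk (hU (σ i)).fst))
  simpa only [Function.comp_def] using h

omit [TopologicalSpace G] [IsTopologicalGroup G] [CompactSpace G] [MeasurableSpace G] [BorelSpace G]
  [SecondCountableTopology G] in
/-- The link-kernel chain is bounded by `C^{#ι}`. -/
theorem abs_prod_linkKer_le {β : ℝ} {M C : ℝ}
    (hC : ∀ (v : ℕ × HalfCfg S S G) (Y : HalfCfg S S G) (v' : ℕ × HalfCfg S S G), |linkKer ρ β M v Y v'| ≤ C)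
    {ι : Type*} [Fintype ι] (σ : ι → ι) (V : ι → ℕ × HalfCfg S S G) (Y : ι → HalfCfg S S G) :
    |∏ i, linkKer ρ β M (V i) (Y (σ i)) (V (σ i))| ≤ C ^ Fintype.card ι := by
  rw [Finset.abs_prod]
  calc ∏ i, |linkKer ρ β M (V i) (Y (σ i)) (V (σ i))| ≤ ∏ _i : ι, C :=
        Finset.prod_le_prod (fun i _ => abs_nonneg _) fun i _ => hC _ _ _
    _ = C ^ Fintype.card ι := by rw [Finset.prod_const, Finset.card_univ]

/-- ★★ **The master lift.**  For a finite index type `ι` with successor permutation `σ`, a bounded measurable insertion `J` of the pair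
string, `β ≥ 0`, `ρ` continuous unitary and a bond bound `M`:
`∫ J(P) ∏_i e^{β even(Y_i,X_i,Y_{σ i})} e^{β odd(X_i,Y_{σ i},X_{σ i})} d(halfHaar⊗halfHaar)^{⊗ι}(P)
   = ∫ J((Y_i,X_i)_i) ∏_i c(V_i, Y_{σ i}, V_{σ i}) d(μ̃ ⊗ halfHaar)^{⊗ι}(U)`, `U_i = (V_i, Y_i)`, `V_i = (k_i, X_i)` —
the inserted pair chain IS the inserted link-kernel chain over the finite reweighted measure, with every bond half layer still present. -/
theorem integral_mul_pairChain_eq_integral_linkChain (hρ : Continuous ρ) {β : ℝ} (hβ : 0 ≤ β)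
    (hρu : ∀ g, ρ g ∈ Matrix.unitaryGroup (Fin Nc) ℂ) {M : ℝ}
    (hM : ∀ (Y : HalfCfg S S G) (j : Fin (featDim S Nc)), |bondVec ρ Y j| ≤ M)
    {ι : Type} [Fintype ι] (σ : ι ≃ ι) {J : (ι → HalfCfg S S G × HalfCfg S S G) → ℝ} (hJm : Measurable J) {B : ℝ}
    (hJb : ∀ P, |J P| ≤ B) :
    ∫ P : ι → HalfCfg S S G × HalfCfg S S G, J P * ∏ i,
        Real.exp (β * evenActionU ρ (P i).1 (P i).2 (P (σ i)).1) * Real.exp (β * oddActionU ρ (P i).2 (P (σ i)).1 (P (σ i)).2)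
        ∂(Measure.pi fun _ : ι => (halfHaar S G).prod (halfHaar S G)) =
      ∫ U : ι → (ℕ × HalfCfg S S G) × HalfCfg S S G,
        J (fun i => ((U i).2, (U i).1.2)) * ∏ i, linkKer ρ β M (U i).1 (U (σ i)).2 (U (σ i)).1
        ∂(Measure.pi fun _ : ι => (tMeasure S G Nc β M).prod (halfHaar S G)) := by
  classical
  haveI : IsProbabilityMeasure (halfHaar S G) := by unfold halfHaar; infer_instance
  haveI := isFiniteMeasure_wMeasure (featDim S Nc) hβ M
  haveI := isFiniteMeasure_tMeasure (S := S) (G := G) (Nc := Nc) hβ M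
  have hB0 : 0 ≤ B := (abs_nonneg _).trans (hJb fun _ => (fun _ => 1, fun _ => 1))
  obtain ⟨C, hC0, hC⟩ := exists_abs_linkKer_le (S := S) ρ hρ β hM
  -- abbreviations
  set η : Measure (HalfCfg S S G) := halfHaar S G with hη
  set μw : Measure ℕ := wMeasure (featDim S Nc) β M with hμw
  set summand : (ι → ℕ) → (ι → HalfCfg S S G) → (ι → HalfCfg S S G) → ℝ := fun k Y X => ∏ i, Real.exp (β * inslabAction ρ (X i)) *
        (natFeature (p := featDim S Nc) β (k i) (bondVec ρ (thetaHalf (Y (σ i)))) *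
          natFeature (p := featDim S Nc) β (k i) (bondVec ρ (Y i))) *
        Real.exp (β * oddActionU ρ (X i) (Y (σ i)) (X (σ i))) with hsummand
  set lk : (ι → ℕ) → (ι → HalfCfg S S G) → (ι → HalfCfg S S G) → ℝ := fun k Y X =>
    ∏ i, linkKer ρ β M (k i, X i) (Y (σ i)) (k (σ i), X (σ i)) with hlk
  set wt : (ι → ℕ) → ℝ := fun k => ∏ i, featWeight (featDim S Nc) β M (k i) with hwt
  have hwt_pos : ∀ k, 0 < wt k := fun k => Finset.prod_pos fun i _ => featWeight_pos _ β M (k i)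
  have hsl : ∀ k Y X, summand k Y X = lk k Y X * wt k := fun k Y X =>
    (prod_linkKer_mul_prod_featWeight ρ β M σ k X Y).symm
  -- LHS as a sum over `k`
  rw [integral_mul_pairChain_eq_tsum ρ hρ hβ hρu σ hJm hJb]
  -- RHS: un-zip `U = (V, Y)`, then `V = (k, X)`
  have hmp1 := measurePreserving_arrowProdEquivProdArrow (ℕ × HalfCfg S S G) (HalfCfg S S G) ι
    (fun _ => tMeasure S G Nc β M) (fun _ => η)
  have hmp2 := measurePreserving_arrowProdEquivProdArrow ℕ (HalfCfg S S G) ι (fun _ => μw) (fun _ => η)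
  set F : (ι → (ℕ × HalfCfg S S G) × HalfCfg S S G) → ℝ := fun U =>
    J (fun i => ((U i).2, (U i).1.2)) * ∏ i, linkKer ρ β M (U i).1 (U (σ i)).2 (U (σ i)).1 with hF
  have hFm : Measurable F := measurable_mul_linkChain ρ hρ β M σ hJm
  have hFb : ∀ U, |F U| ≤ B * C ^ Fintype.card ι := fun U => by
    rw [hF]; dsimp only; rw [abs_mul]
    exact mul_le_mul (hJb _) (abs_prod_linkKer_le ρ hC σ (fun i => (U i).1) (fun i => (U i).2)) (abs_nonneg _) hB0
  -- the three-variable form of `F`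
  set F3 : ((ι → ℕ) × (ι → HalfCfg S S G)) × (ι → HalfCfg S S G) → ℝ := fun q =>
    J (fun i => (q.2 i, q.1.2 i)) * lk q.1.1 q.2 q.1.2 with hF3
  have hF3_eq : ∀ q : ((ι → ℕ) × (ι → HalfCfg S S G)) × (ι → HalfCfg S S G),
      F3 q = F ((MeasurableEquiv.arrowProdEquivProdArrow (ℕ × HalfCfg S S G) (HalfCfg S S G) ι).symm
        ((MeasurableEquiv.arrowProdEquivProdArrow ℕ (HalfCfg S S G) ι).symm q.1, q.2)) := fun q => rfl
  have hF3m : Measurable F3 := by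
    have h : Measurable fun q : ((ι → ℕ) × (ι → HalfCfg S S G)) × (ι → HalfCfg S S G) =>
        ((MeasurableEquiv.arrowProdEquivProdArrow (ℕ × HalfCfg S S G) (HalfCfg S S G) ι).symm
          ((MeasurableEquiv.arrowProdEquivProdArrow ℕ (HalfCfg S S G) ι).symm q.1, q.2)) :=
      (MeasurableEquiv.measurable _).comp (((MeasurableEquiv.measurable _).comp measurable_fst).prodMk measurable_snd)
    exact hFm.comp h
  have hF3b : ∀ q, |F3 q| ≤ B * C ^ Fintype.card ι := fun q => by rw [hF3_eq]; exact hFb _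
  have hF3i : Integrable F3 (((Measure.pi fun _ : ι => μw).prod (Measure.pi fun _ : ι => η)).prod (Measure.pi fun _ : ι => η)) :=
    Integrable.of_bound hF3m.aestronglyMeasurable (B * C ^ Fintype.card ι)
      (ae_of_all _ fun q => by simpa only [Real.norm_eq_abs] using hF3b q)
  have step1 : ∫ U, F U ∂(Measure.pi fun _ : ι => (tMeasure S G Nc β M).prod η) =
      ∫ q, F3 q ∂(((Measure.pi fun _ : ι => μw).prod (Measure.pi fun _ : ι => η)).prod (Measure.pi fun _ : ι => η)) := by
    rw [← (hmp1.symm _).integral_comp' (f := (MeasurableEquiv.arrowProdEquivProdArrow _ _ ι).symm) F]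
    have h2 : MeasurePreserving (Prod.map (MeasurableEquiv.arrowProdEquivProdArrow ℕ (HalfCfg S S G) ι).symm id)
        (((Measure.pi fun _ : ι => μw).prod (Measure.pi fun _ : ι => η)).prod (Measure.pi fun _ : ι => η))
        ((Measure.pi fun _ : ι => tMeasure S G Nc β M).prod (Measure.pi fun _ : ι => η)) := by
      have h := (hmp2.symm _).prod (MeasurePreserving.id (Measure.pi fun _ : ι => η))
      exact h
    rw [← h2.integral_comp ((MeasurableEquiv.arrowProdEquivProdArrow ℕ (HalfCfg S S G) ι).symm.measurableEmbedding.prodMap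
      MeasurableEmbedding.id)]
    rfl
  rw [hF, step1, integral_prod _ hF3i, integral_prod _ hF3i.integral_prod_left, integral_countable (hF3i.integral_prod_left).integral_prod_left]
  refine tsum_congr fun k => ?_
  -- the `k`-th term: atoms of `(w·count)^{⊗ι}` and Fubini on the pair string
  rw [measureReal_def, Measure.pi_singleton, ENNReal.toReal_prod]
  simp only [hμw, wMeasure_singleton, ENNReal.toReal_ofReal (featWeight_pos _ _ _ _).le]
  rw [smul_eq_mul]
  -- LHS_k : un-zip `P = (Y, X)` and Fubini with `X` outside
  have hmp3 := measurePreserving_arrowProdEquivProdArrow (HalfCfg S S G) (HalfCfg S S G) ι (fun _ => η) (fun _ => η)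
  set Lk : (ι → HalfCfg S S G) × (ι → HalfCfg S S G) → ℝ := fun q => J (fun i => (q.1 i, q.2 i)) * summand k q.1 q.2 with hLk
  have hLk_eq : ∀ P : ι → HalfCfg S S G × HalfCfg S S G, J P * ∏ i, Real.exp (β * inslabAction ρ (P i).2) *
        (natFeature (p := featDim S Nc) β (k i) (bondVec ρ (thetaHalf (P (σ i)).1)) *
          natFeature (p := featDim S Nc) β (k i) (bondVec ρ (P i).1)) *
        Real.exp (β * oddActionU ρ (P i).2 (P (σ i)).1 (P (σ i)).2) =
      Lk (MeasurableEquiv.arrowProdEquivProdArrow (HalfCfg S S G) (HalfCfg S S G) ι P) := fun P => rfl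
  simp_rw [hLk_eq]
  rw [hmp3.integral_comp' (f := MeasurableEquiv.arrowProdEquivProdArrow _ _ ι) Lk]
  have hLkm : Measurable Lk := by
    have h := (hJm.mul (measurable_chainSummand ρ hρ β σ k)).comp
      (MeasurableEquiv.arrowProdEquivProdArrow (HalfCfg S S G) (HalfCfg S S G) ι).symm.measurable
    exact h
  obtain ⟨Bc, hBc⟩ := exists_hasSum_abs_chainSummand_le (S := S) (Nc := Nc) ρ hρ hβ σ
  have hLki : Integrable Lk ((Measure.pi fun _ : ι => η).prod (Measure.pi fun _ : ι => η)) := by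
    refine Integrable.of_bound hLkm.aestronglyMeasurable (B * Bc) (ae_of_all _ fun q => ?_)
    obtain ⟨s, hs, hsB⟩ := hBc q.1 q.2
    rw [Real.norm_eq_abs, hLk]; dsimp only; rw [abs_mul]
    exact mul_le_mul (hJb _) ((le_hasSum hs k fun _ _ => abs_nonneg _).trans hsB)
      (abs_nonneg _) hB0
  rw [integral_prod_symm _ hLki]
  -- compare the `X`-integrands
  rw [← integral_const_mul]
  refine integral_congr_ae (ae_of_all _ fun X => ?_)
  dsimp only
  rw [← integral_const_mul]
  refine integral_congr_ae (ae_of_all _ fun Y => ?_)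
  rw [hLk, hF3]
  dsimp only
  rw [hsl k Y X]
  ring

end Lift

end Summit.QuantumFields.YangMills.Cruxes.DiagonalMirrorRPR.SignTwistedDiagonalTrace.WilsonDiagonal

end
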